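import Literature.Barriers.CriticalPhenomena.LaceExpansionIsingDeconvolutionProp12
import Literature.Barriers.CriticalPhenomena.LaceExpansionIsingGreenUniform
import Mathlib.Analysis.SpecificLimits.Normed
import Mathlib.Analysis.SpecialFunctions.Trigonometric.Complex
import HarnessLib

/-!
# Liu–Slade 2026, Prop. 1.2: the Fourier representation of `φ = S_1 - δ - σ^{-2}C_1`
# (`LiuSlade2026_prop12_fourierRep_holds`)

Barrier catalogue `Literature/Barriers/CriticalPhenomena/` (D-0021); discharges the named fact
`SpreadOutIsing.LiuSlade2026_prop12_fourierRep` of `LaceExpansionIsingDeconvolutionProp12.lean`: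
for `d > 2`, `L ≥ 1` and every `x ∈ ℤ^d`,
`S_1(x) - δ_{0,x} - C_1(x)/σ² = ∫_{[-π,π]^d} φ̂(k) cos(k·x) dk/(2π)^d`, `φ̂ = soPhiHat d L ∈ L¹`,
where `S_1 = Σ_n D^{*n}` (`soGreen d L 1`) and `C_1 = Σ_n D_nn^{*n}` (`srwGreen d`) are the tree's
SERIES and the right side is the source's Fourier-integral DEFINITION (1.7) of the Green
functions (`Ŝ_1 = 1/(1 - D̂)`, `Ĉ_1 = 1/(1 - D̂_nn) = d/ε`) combined as in (5.4).

Route (Fourier inversion (1.4) term by term, then `Σ_n D̂ⁿ = 1/(1 - D̂)` under the integral):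
* a finitely supported, symmetric, non-negative step function `f` with symbol
  `f̂(k) = Σ_y f(y) cos(k·y)` has `f^{*n}(x) = ∫ f̂ⁿ cos(k·x) dk/(2π)^d` (`convPow_eq_integral_of_support`,
  the tree's `convPow_eq_integral` made generic), and if `|f̂| < 1` a.e. with `1/(1 - f̂) ∈ L¹` then
  `Σ_n f^{*n}(x) = ∫ cos(k·x)/(1 - f̂(k)) dk/(2π)^d` (`hasSum_convPow_of_support`: dominated
  convergence with `|Σ_{n<M} f̂ⁿ| ≤ 2/(1 - f̂)`);
* for `D = soStep d L` (`d ≥ 3`, `L ≥ 1`) this is already in the tree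
  (`soGreen_eq_integral`, `integrableOn_inv_one_sub_soSymbol` of
  `LaceExpansionIsingGreenUniform.lean`, reused at `μ = 1`); for `D_nn = srwStep d`:
  `D̂_nn = 1 - ε/d`, `|D̂_nn| < 1` off the origin and the null set `{cos k₁ = -1}`,
  `1/(1 - D̂_nn) = d/ε ∈ L¹` (`integrable_indicator_inv_dispersion`);
* `δ_{0,x} = ∫ cos(k·x) dk/(2π)^d` (`integral_cube_cos_kdot`), and linearity.

## References

* Y. Liu, G. Slade, *Gaussian deconvolution and the lace expansion for spread-out models*,
  Ann. Inst. H. Poincaré Probab. Statist. 62 (2026), arXiv:2310.07640: (1.4), (1.6)–(1.8), (5.4),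
  (5.8) [LiuSlade2026].
-/

noncomputable section

namespace Literature.Barriers.CriticalPhenomena.SpreadOutIsing

open Filter Finset Literature.Probability.LatticeModels Real
open Literature.Probability.Percolation (kdot_neg)
open _root_.MeasureTheory _root_.Topology

variable {d L : ℕ}

/-! ### Finitely supported symmetric steps: Fourier representation of the convolution powers -/

section FiniteStep

variable {f : Site d → ℝ} {S : Finset (Site d)}

/-- The symbol `f̂(k) = Σ_{y ∈ S} f(y) cos(k·y)` of a step function `f` supported in `S`.
[cite: LiuSlade2026, (1.4) and (1.7) (D̂)] -/
def stepSymbol (f : Site d → ℝ) (S : Finset (Site d)) (k : Fin d → ℝ) : ℝ :=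
  ∑ y ∈ S, f y * Real.cos (kdot k y)

/-- `f̂` is continuous. [folklore] -/
theorem continuous_stepSymbol (f : Site d → ℝ) (S : Finset (Site d)) :
    Continuous (stepSymbol f S) :=
  continuous_finsetSum _ fun y _ => continuous_const.mul
    (Real.continuous_cos.comp (continuous_kdot_left y))

/-- Convolution with a step supported in `S` is a finite sum: `(g * f)(w) = Σ_{y ∈ S} f(y) g(w - y)`.
[folklore] -/
theorem latticeConv_eq_sum_of_support (hS : ∀ y ∉ S, f y = 0) (g : Site d → ℝ) (w : Site d) :
    latticeConv g f w = ∑ y ∈ S, f y * g (w - y) := by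
  unfold latticeConv
  have hinj : Set.InjOn (fun y : Site d => w - y) ↑S := fun a _ b _ h => sub_right_injective h
  rw [tsum_eq_sum (s := S.image fun y => w - y)]
  · rw [Finset.sum_image hinj]
    refine Finset.sum_congr rfl fun y _ => ?_
    rw [sub_sub_cancel, mul_comm]
  · intro u hu
    rw [hS (w - u), mul_zero]
    intro h
    exact hu (Finset.mem_image.2 ⟨w - u, h, sub_sub_cancel w u⟩)

/-- `f^{*(n+1)}(w) = Σ_{y ∈ S} f(y) f^{*n}(w - y)`. [folklore] -/
theorem convPow_succ_eq_sum_of_support (hS : ∀ y ∉ S, f y = 0) (n : ℕ) (w : Site d) :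
    convPow f (n + 1) w = ∑ y ∈ S, f y * convPow f n (w - y) :=
  latticeConv_eq_sum_of_support hS _ w

/-- `f^{*n} ≥ 0` for `f ≥ 0`. [folklore] -/
theorem convPow_nonneg_of_nonneg (hf : ∀ y, 0 ≤ f y) (n : ℕ) (x : Site d) : 0 ≤ convPow f n x := by
  induction n generalizing x with
  | zero => exact delta0_nonneg x
  | succ n ih => exact tsum_nonneg fun y => mul_nonneg (ih y) (hf _)

/-- The sine part of the symbol vanishes for a symmetric step on a symmetric support. [folklore] -/
theorem sum_mul_sin_kdot_eq_zero (hsymm : ∀ y ∈ S, -y ∈ S) (hf : ∀ y, f (-y) = f y)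
    (k : Fin d → ℝ) : ∑ y ∈ S, f y * Real.sin (kdot k y) = 0 := by
  set T := ∑ y ∈ S, f y * Real.sin (kdot k y) with hT
  have hneg : T = -T := by
    calc T = ∑ y ∈ S, f (-y) * Real.sin (kdot k (-y)) := by
          rw [hT]
          exact Finset.sum_nbij' (fun y => -y) (fun y => -y) (fun y hy => hsymm y hy)
            (fun y hy => hsymm y hy) (fun y _ => neg_neg y) (fun y _ => neg_neg y)
            (fun y _ => by rw [neg_neg])
      _ = -T := by
          rw [hT, ← Finset.sum_neg_distrib]
          refine Finset.sum_congr rfl fun y _ => ?_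
          rw [hf, kdot_neg, Real.sin_neg, mul_neg]
  linarith

/-- `Σ_{y ∈ S} f(y) cos(k·(x - y)) = f̂(k) cos(k·x)` for a symmetric step. [folklore] -/
theorem sum_mul_cos_kdot_sub (hsymm : ∀ y ∈ S, -y ∈ S) (hf : ∀ y, f (-y) = f y)
    (k : Fin d → ℝ) (x : Site d) :
    ∑ y ∈ S, f y * Real.cos (kdot k (x - y)) = stepSymbol f S k * Real.cos (kdot k x) := by
  simp_rw [kdot_sub, Real.cos_sub, mul_add, Finset.sum_add_distrib]
  have h1 : ∑ y ∈ S, f y * (Real.cos (kdot k x) * Real.cos (kdot k y)) =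
      stepSymbol f S k * Real.cos (kdot k x) := by
    unfold stepSymbol
    rw [Finset.sum_mul]
    exact Finset.sum_congr rfl fun y _ => by ring
  have h2 : ∑ y ∈ S, f y * (Real.sin (kdot k x) * Real.sin (kdot k y)) = 0 := by
    calc ∑ y ∈ S, f y * (Real.sin (kdot k x) * Real.sin (kdot k y))
        = Real.sin (kdot k x) * ∑ y ∈ S, f y * Real.sin (kdot k y) := by
          rw [Finset.mul_sum]; exact Finset.sum_congr rfl fun y _ => by ring
      _ = 0 := by rw [sum_mul_sin_kdot_eq_zero hsymm hf, mul_zero]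
  rw [h1, h2, add_zero]

/-- **`f^{*n}(x) = (2π)^{-d} ∫_{[-π,π]^d} f̂(k)ⁿ cos(k·x) dk`** for a finitely supported symmetric
step (Fourier inversion (1.4), term by term; the tree's `convPow_eq_integral` made generic).
[cite: LiuSlade2026, (1.4) and (1.7)] -/
theorem convPow_eq_integral_of_support (hS : ∀ y ∉ S, f y = 0) (hsymm : ∀ y ∈ S, -y ∈ S)
    (hf : ∀ y, f (-y) = f y) (n : ℕ) (x : Site d) :
    convPow f n x = ((2 * π) ^ d)⁻¹ * ∫ k in cube d, stepSymbol f S k ^ n * Real.cos (kdot k x) := by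
  have hπ : ((2 * π) ^ d : ℝ) ≠ 0 := pow_ne_zero _ (by positivity)
  have hint : ∀ (m : ℕ) (z : Site d),
      IntegrableOn (fun k => stepSymbol f S k ^ m * Real.cos (kdot k z)) (cube d) volume := fun m z =>
    ContinuousOn.integrableOn_compact (isCompact_univ_pi fun _ => isCompact_Icc)
      (((continuous_stepSymbol f S).pow m).mul
        (Real.continuous_cos.comp (continuous_kdot_left z))).continuousOn
  induction n generalizing x with
  | zero =>
    simp only [pow_zero, one_mul]
    rw [integral_cube_cos_kdot]
    unfold convPow delta0
    split_ifs
    · rw [inv_mul_cancel₀ hπ]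
    · rw [mul_zero]
  | succ n ih =>
    rw [convPow_succ_eq_sum_of_support hS]
    have hswap : ∫ k in cube d, stepSymbol f S k ^ (n + 1) * Real.cos (kdot k x) =
        ∑ y ∈ S, f y * ∫ k in cube d, stepSymbol f S k ^ n * Real.cos (kdot k (x - y)) := by
      have hfun : (fun k => stepSymbol f S k ^ (n + 1) * Real.cos (kdot k x)) =
          fun k => ∑ y ∈ S, f y * (stepSymbol f S k ^ n * Real.cos (kdot k (x - y))) := by
        funext k
        rw [pow_succ, mul_assoc, ← sum_mul_cos_kdot_sub hsymm hf k x, Finset.mul_sum]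
        exact Finset.sum_congr rfl fun y _ => by ring
      rw [hfun, integral_finsetSum _ fun y _ => (hint n (x - y)).const_mul (f y)]
      exact Finset.sum_congr rfl fun y _ => integral_const_mul _ _
    rw [hswap, Finset.mul_sum]
    refine Finset.sum_congr rfl fun y _ => ?_
    rw [ih (x - y)]
    ring

/-- **`Σ_n f^{*n}(x) = (2π)^{-d} ∫ cos(k·x)/(1 - f̂(k)) dk`** for a finitely supported, symmetric,
non-negative step with `|f̂| < 1` a.e. on the cube and `1/(1 - f̂)` integrable: partial sums are
`∫ (Σ_{n<M} f̂ⁿ) cos`, dominated by `2/(1 - f̂)`, and converge a.e. (the source's definition (1.7)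
of the Green function by the Fourier integral, as a theorem about the series (1.6)).
[cite: LiuSlade2026, (1.6)–(1.7)] -/
theorem hasSum_convPow_of_support (hS : ∀ y ∉ S, f y = 0) (hsymm : ∀ y ∈ S, -y ∈ S)
    (hf : ∀ y, f (-y) = f y) (hnn : ∀ y, 0 ≤ f y)
    (hlt : ∀ᵐ k ∂(volume.restrict (cube d)), |stepSymbol f S k| < 1)
    (hinv : IntegrableOn (fun k => (1 - stepSymbol f S k)⁻¹) (cube d) volume) (x : Site d) :
    HasSum (fun n => convPow f n x)
      (((2 * π) ^ d)⁻¹ * ∫ k in cube d, (1 - stepSymbol f S k)⁻¹ * Real.cos (kdot k x)) := by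
  rw [hasSum_iff_tendsto_nat_of_nonneg (fun n => convPow_nonneg_of_nonneg hnn n x)]
  -- partial sums as one integral
  set F : ℕ → (Fin d → ℝ) → ℝ := fun M k =>
    (∑ n ∈ Finset.range M, stepSymbol f S k ^ n) * Real.cos (kdot k x) with hF
  have hcontF : ∀ M, Continuous (F M) := fun M =>
    (continuous_finsetSum _ fun n _ => (continuous_stepSymbol f S).pow n).mul
      (Real.continuous_cos.comp (continuous_kdot_left x))
  have hint : ∀ m : ℕ, IntegrableOn (fun k => stepSymbol f S k ^ m * Real.cos (kdot k x)) (cube d)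
      volume := fun m =>
    ContinuousOn.integrableOn_compact (isCompact_univ_pi fun _ => isCompact_Icc)
      (((continuous_stepSymbol f S).pow m).mul
        (Real.continuous_cos.comp (continuous_kdot_left x))).continuousOn
  have hsum : ∀ M, ∑ n ∈ Finset.range M, convPow f n x = ((2 * π) ^ d)⁻¹ * ∫ k in cube d, F M k := by
    intro M
    simp_rw [convPow_eq_integral_of_support hS hsymm hf, ← Finset.mul_sum]
    congr 1
    rw [← integral_finsetSum _ fun n _ => hint n]
    refine integral_congr_ae (ae_of_all _ fun k => ?_)
    simp only [hF, Finset.sum_mul]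
  simp_rw [hsum]
  refine Tendsto.const_mul _ ?_
  -- dominated convergence
  refine tendsto_integral_of_dominated_convergence (fun k => 2 * (1 - stepSymbol f S k)⁻¹)
    (fun M => (hcontF M).aestronglyMeasurable) (hinv.const_mul 2) (fun M => ?_) ?_
  · filter_upwards [hlt] with k hk
    have hk' := abs_lt.1 hk
    have h1 : 0 < 1 - stepSymbol f S k := by linarith
    rw [Real.norm_eq_abs, hF]
    simp only
    rw [abs_mul]
    calc |∑ n ∈ Finset.range M, stepSymbol f S k ^ n| * |Real.cos (kdot k x)|
        ≤ 2 / (1 - stepSymbol f S k) * 1 :=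
          mul_le_mul (abs_geom_sum_le hk'.1.le hk'.2 M) (Real.abs_cos_le_one _) (abs_nonneg _)
            (div_nonneg zero_le_two h1.le)
      _ = 2 * (1 - stepSymbol f S k)⁻¹ := by rw [mul_one, div_eq_mul_inv]
  · filter_upwards [hlt] with k hk
    have h := (hasSum_geometric_of_abs_lt_one hk).tendsto_sum_nat
    simpa only [hF] using h.mul_const (Real.cos (kdot k x))

end FiniteStep

/-! ### Null sets: `{k : cos k_i = -1}` and the origin -/

/-- `{θ : cos θ = -1} = π + 2πℤ` is countable, hence Lebesgue-null. [folklore] -/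
theorem volume_cos_eq_neg_one : volume {θ : ℝ | Real.cos θ = -1} = 0 := by
  refine Set.Countable.measure_zero ?_ _
  refine (Set.countable_range fun m : ℤ => π + m * (2 * π)).mono fun θ hθ => ?_
  obtain ⟨m, hm⟩ := Real.cos_eq_neg_one_iff.1 hθ
  exact ⟨m, hm⟩

/-- In `ℝ^d`, `{k : cos k_i = -1}` is Lebesgue-null. [folklore] -/
theorem volume_cos_apply_eq_neg_one (i : Fin d) :
    volume {k : Fin d → ℝ | Real.cos (k i) = -1} = 0 := by
  show Measure.pi (fun _ : Fin d => (volume : Measure ℝ))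
    (Function.eval i ⁻¹' {θ : ℝ | Real.cos θ = -1}) = 0
  exact Measure.pi_eval_preimage_null (fun _ : Fin d => (volume : Measure ℝ)) volume_cos_eq_neg_one

/-- Almost every point of the cube is not the origin and has `cos k_i ≠ -1` (`d ≥ 1`). [folklore] -/
theorem ae_restrict_cube_ne_zero_and_cos_ne (hd : 1 ≤ d) :
    ∀ᵐ k ∂(volume.restrict (cube d)),
      k ≠ (0 : Fin d → ℝ) ∧ Real.cos (k ⟨0, hd⟩) ≠ -1 ∧ k ∈ cube d := by
  haveI : Nonempty (Fin d) := ⟨⟨0, hd⟩⟩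
  have h0 : ∀ᵐ k ∂(volume.restrict (cube d)), k ≠ (0 : Fin d → ℝ) := by
    rw [ae_iff]
    have hsub : {k : Fin d → ℝ | ¬k ≠ 0} ⊆ {0} := fun k hk => by simpa using hk
    exact le_antisymm ((((measure_mono hsub).trans (Measure.restrict_apply_le _ _))).trans
      (measure_singleton _).le) bot_le
  have h1 : ∀ᵐ k ∂(volume.restrict (cube d)), Real.cos (k ⟨0, hd⟩) ≠ -1 := by
    rw [ae_iff]
    have hsub : {k : Fin d → ℝ | ¬Real.cos (k ⟨0, hd⟩) ≠ -1} ⊆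
        {k : Fin d → ℝ | Real.cos (k ⟨0, hd⟩) = -1} := fun k hk => by simpa using hk
    exact le_antisymm ((((measure_mono hsub).trans (Measure.restrict_apply_le _ _))).trans
      (volume_cos_apply_eq_neg_one _).le) bot_le
  filter_upwards [h0, h1, self_mem_ae_restrict (measurableSet_brillouin d)] with k hk0 hk1 hk
  exact ⟨hk0, hk1, hk⟩

/-! ### The spread-out walk

For `D = soStep d L` the Fourier representation `S_μ(x) = (2π)^{-d}∫ cos(k·x)/(1 - μD̂(k)) dk`
(`d ≥ 3`, `L ≥ 1`, `μ ∈ [0,1]`) and the integrability of `1/(1 - D̂)` are the tree's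
`soGreen_eq_integral` and `integrableOn_inv_one_sub_soSymbol` (`LaceExpansionIsingGreenUniform.lean`);
they are used below at `μ = 1`. -/

/-! ### The simple walk: `C_1(x) = (2π)^{-d} ∫ cos(k·x) d/ε(k) dk` -/

/-- The neighbours of the origin in `ℤ^d` are `± eᵢ`. [folklore] -/
theorem neighborFinset_zdGraph_zero :
    (zdGraph d).neighborFinset 0 = (Finset.univ : Finset (Fin d × Bool)).image
      (fun p => if p.2 then (Pi.single p.1 1 : Site d) else -Pi.single p.1 1) := by
  ext y
  simp only [SimpleGraph.mem_neighborFinset, Finset.mem_image, Finset.mem_univ, true_and,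
    zdGraph_adj_iff, zero_add]
  constructor
  · rintro ⟨i, h | h⟩
    · exact ⟨(i, true), by simp [h]⟩
    · refine ⟨(i, false), ?_⟩
      simp only [Bool.false_eq_true, ↓reduceIte]
      exact (eq_neg_of_add_eq_zero_left h.symm).symm
  · rintro ⟨⟨i, b⟩, rfl⟩
    cases b
    · exact ⟨i, Or.inr (by simp)⟩
    · exact ⟨i, Or.inl (by simp)⟩

/-- `(i, ±) ↦ ±eᵢ` is injective. [folklore] -/
theorem unitStep_injective : Function.Injective
    (fun p : Fin d × Bool => if p.2 then (Pi.single p.1 (1 : ℤ) : Site d) else -Pi.single p.1 1) := by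
  rintro ⟨i, b⟩ ⟨j, c⟩ h
  have hi := congrFun h i
  have hj := congrFun h j
  cases b <;> cases c <;>
    simp only [Bool.false_eq_true, ↓reduceIte, Pi.neg_apply, Pi.single_apply] at hi hj <;>
    split_ifs at hi hj <;> first | (subst_vars; rfl) | omega

/-- Sums over the neighbours of the origin of `ℤ^d`: `Σ_{y ∼ 0} g(y) = Σᵢ (g(eᵢ) + g(-eᵢ))`. [folklore] -/
theorem sum_neighborFinset_zdGraph_zero (g : Site d → ℝ) :
    ∑ y ∈ (zdGraph d).neighborFinset 0, g y = ∑ i : Fin d, (g (Pi.single i 1) + g (-Pi.single i 1)) := by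
  rw [neighborFinset_zdGraph_zero, Finset.sum_image fun p _ q _ h => unitStep_injective h,
    Fintype.sum_prod_type]
  refine Finset.sum_congr rfl fun i _ => ?_
  rw [Fintype.sum_bool, if_pos rfl, if_neg Bool.false_ne_true]

/-- The neighbourhood of the origin of `ℤ^d` is symmetric. [folklore] -/
theorem neg_mem_neighborFinset_zdGraph_zero {y : Site d} (hy : y ∈ (zdGraph d).neighborFinset 0) :
    -y ∈ (zdGraph d).neighborFinset 0 := by
  rw [SimpleGraph.mem_neighborFinset, zdGraph_adj_iff] at hy ⊢
  obtain ⟨i, h | h⟩ := hy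
  · refine ⟨i, Or.inr ?_⟩
    rw [zero_add] at h
    rw [h, neg_add_cancel]
  · refine ⟨i, Or.inl ?_⟩
    rw [zero_add]
    exact neg_eq_of_add_eq_zero_right h.symm

/-- `D_nn` vanishes off the neighbourhood of the origin. [folklore] -/
theorem srwStep_of_not_mem {y : Site d} (hy : y ∉ (zdGraph d).neighborFinset 0) : srwStep d y = 0 :=
  if_neg fun h => hy ((SimpleGraph.mem_neighborFinset _ _ _).2 h)

/-- `D_nn(-y) = D_nn(y)`. [folklore] -/
theorem srwStep_neg (y : Site d) : srwStep d (-y) = srwStep d y := by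
  unfold srwStep
  have h : (zdGraph d).Adj 0 (-y) ↔ (zdGraph d).Adj 0 y := by
    rw [← SimpleGraph.mem_neighborFinset, ← SimpleGraph.mem_neighborFinset]
    exact ⟨fun h => by simpa using neg_mem_neighborFinset_zdGraph_zero h,
      neg_mem_neighborFinset_zdGraph_zero⟩
  exact if_congr h rfl rfl

/-- **`D̂_nn(k) = d^{-1} Σ_j cos k_j = 1 - ε(k)/d`** (`d ≥ 1`; (5.8)). [cite: LiuSlade2026, (5.8)] -/
theorem stepSymbol_srwStep (hd : 1 ≤ d) (k : Fin d → ℝ) :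
    stepSymbol (srwStep d) ((zdGraph d).neighborFinset 0) k = 1 - dispersion k / d := by
  have hd' : (d : ℝ) ≠ 0 := by exact_mod_cast (show d ≠ 0 by omega)
  have hval : ∀ y ∈ (zdGraph d).neighborFinset 0, srwStep d y = 1 / (2 * d) := fun y hy =>
    if_pos ((SimpleGraph.mem_neighborFinset _ _ _).1 hy)
  unfold stepSymbol
  rw [Finset.sum_congr rfl fun y hy => by rw [hval y hy], sum_neighborFinset_zdGraph_zero]
  simp only [kdot_neg, Real.cos_neg, kdot_single_right]
  unfold dispersion
  rw [Finset.sum_sub_distrib, Finset.sum_const, Finset.card_univ, Fintype.card_fin, nsmul_eq_mul,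
    mul_one]
  have hsum : ∑ i, (1 / (2 * (d : ℝ)) * Real.cos (k i) + 1 / (2 * (d : ℝ)) * Real.cos (k i)) =
      (∑ i, Real.cos (k i)) / d := by
    rw [Finset.sum_div]
    exact Finset.sum_congr rfl fun i _ => by ring
  rw [hsum]
  field_simp
  ring

/-- **`C_1(x) = Σ_n D_nn^{*n}(x) = (2π)^{-d} ∫_{[-π,π]^d} cos(k·x) (ε(k)/d)^{-1} dk`** for `d ≥ 3`
(the source's (1.7)–(1.8) for the simple walk, `Ĉ_1 = 1/(1 - D̂_nn)`, (5.8); so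
`C_1 = d × latticeGreen` of the tree). [cite: LiuSlade2026, (1.7)–(1.8) and (5.8)] -/
theorem srwGreen_eq_integral (hd : 3 ≤ d) (x : Site d) :
    srwGreen d x = ((2 * π) ^ d)⁻¹ * ∫ k in cube d, (dispersion k / d)⁻¹ * Real.cos (kdot k x) := by
  have hd1 : 1 ≤ d := by omega
  have hd' : (0 : ℝ) < d := by exact_mod_cast (show 0 < d by omega)
  have hsymb : ∀ k, 1 - stepSymbol (srwStep d) ((zdGraph d).neighborFinset 0) k = dispersion k / d :=
    fun k => by rw [stepSymbol_srwStep hd1]; ring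
  have hlt : ∀ᵐ k ∂(volume.restrict (cube d)),
      |stepSymbol (srwStep d) ((zdGraph d).neighborFinset 0) k| < 1 := by
    filter_upwards [ae_restrict_cube_ne_zero_and_cos_ne hd1] with k hk
    rw [stepSymbol_srwStep hd1]
    have hε : 0 < dispersion k := dispersion_pos_of_mem_brillouin hk.2.2 hk.1
    -- `ε < 2d` unless every `cos k_i = -1`
    have hεlt : dispersion k < 2 * d := by
      unfold dispersion
      have hcos : -1 < Real.cos (k ⟨0, hd1⟩) :=
        lt_of_le_of_ne (Real.neg_one_le_cos _) (Ne.symm hk.2.1)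
      calc ∑ i, (1 - Real.cos (k i)) < ∑ _i : Fin d, (2 : ℝ) := by
            refine Finset.sum_lt_sum (fun i _ => by linarith [Real.neg_one_le_cos (k i)])
              ⟨⟨0, hd1⟩, Finset.mem_univ _, by linarith⟩
        _ = 2 * d := by simp [mul_comm]
    rw [abs_lt]
    constructor
    · have : dispersion k / d < 2 := by rw [div_lt_iff₀ hd']; linarith
      linarith
    · have : 0 < dispersion k / d := div_pos hε hd'
      linarith
  have hinv : IntegrableOn (fun k => (1 - stepSymbol (srwStep d) ((zdGraph d).neighborFinset 0) k)⁻¹)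
      (cube d) volume := by
    simp_rw [hsymb]
    have hG : IntegrableOn (fun k : Fin d → ℝ => (d : ℝ) * (1 / dispersion k)) (cube d) volume :=
      ((integrable_indicator_iff (measurableSet_brillouin d)).1
        (integrable_indicator_inv_dispersion (d := d) hd)).const_mul _
    refine hG.congr_fun (fun k _ => ?_) (measurableSet_brillouin d)
    show (d : ℝ) * (1 / dispersion k) = (dispersion k / d)⁻¹
    rw [inv_div, mul_one_div]
  have h := hasSum_convPow_of_support (f := srwStep d) (S := (zdGraph d).neighborFinset 0)
    (fun y hy => srwStep_of_not_mem hy) (fun y hy => neg_mem_neighborFinset_zdGraph_zero hy)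
    srwStep_neg (srwStep_nonneg d) hlt hinv x
  unfold srwGreen
  rw [h.tsum_eq]
  simp_rw [hsymb]

/-! ### The theorem -/

/-- **Discharge of `LiuSlade2026_prop12_fourierRep`**: for `d ≥ 3`, `L ≥ 1`,
`φ̂ = 1/(1 - D̂) - 1 - σ^{-2}(ε/d)^{-1}` is integrable on `[-π,π]^d` and
`S_1(x) - δ_{0,x} - C_1(x)/σ² = (2π)^{-d}∫ φ̂(k) cos(k·x) dk` ((5.4) via (1.4), (1.6)–(1.8)).
[cite: LiuSlade2026, (1.4), (1.6)–(1.8) and (5.4)] -/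
theorem LiuSlade2026_prop12_fourierRep_holds : LiuSlade2026_prop12_fourierRep := by
  intro d hd L hL
  have hd1 : 1 ≤ d := by omega
  have hcube : IsCompact (cube d) := isCompact_univ_pi fun _ => isCompact_Icc
  -- the three integrable symbols
  have hA : IntegrableOn (fun k => (1 - soSymbol d L k)⁻¹) (cube d) volume :=
    (integrableOn_inv_one_sub_soSymbol hd hL).congr_fun (fun k _ => one_div _)
      (measurableSet_brillouin d)
  have hB : IntegrableOn (fun k : Fin d → ℝ => (dispersion k / d)⁻¹) (cube d) volume := by
    have hG : IntegrableOn (fun k : Fin d → ℝ => (d : ℝ) * (1 / dispersion k)) (cube d) volume :=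
      ((integrable_indicator_iff (measurableSet_brillouin d)).1
        (integrable_indicator_inv_dispersion (d := d) hd)).const_mul _
    refine hG.congr_fun (fun k _ => ?_) (measurableSet_brillouin d)
    show (d : ℝ) * (1 / dispersion k) = (dispersion k / d)⁻¹
    rw [inv_div, mul_one_div]
  have h1 : IntegrableOn (fun _ : Fin d → ℝ => (1 : ℝ)) (cube d) volume :=
    continuousOn_const.integrableOn_compact hcube
  have hφ : IntegrableOn (soPhiHat d L) (cube d) volume :=
    (hA.sub h1).sub (hB.const_mul _)
  refine ⟨hφ, fun x => ?_⟩
  have hcos : Continuous fun k : Fin d → ℝ => Real.cos (kdot k x) :=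
    Real.continuous_cos.comp (continuous_kdot_left x)
  have hAc := hA.mul_continuousOn hcos.continuousOn hcube
  have hBc := hB.mul_continuousOn hcos.continuousOn hcube
  have h1c : IntegrableOn (fun k : Fin d → ℝ => Real.cos (kdot k x)) (cube d) volume :=
    hcos.continuousOn.integrableOn_compact hcube
  -- the three Fourier representations
  have hδ : delta0 x = ((2 * π) ^ d)⁻¹ * ∫ k in cube d, Real.cos (kdot k x) := by
    have hπ : ((2 * π) ^ d : ℝ) ≠ 0 := pow_ne_zero _ (by positivity)
    rw [integral_cube_cos_kdot]
    unfold delta0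
    split_ifs
    · rw [inv_mul_cancel₀ hπ]
    · rw [mul_zero]
  have hI : ∫ k in cube d, soPhiHat d L k * Real.cos (kdot k x) =
      (∫ k in cube d, (1 - soSymbol d L k)⁻¹ * Real.cos (kdot k x)) -
        (∫ k in cube d, Real.cos (kdot k x)) -
        (soVariance d L)⁻¹ * ∫ k in cube d, (dispersion k / d)⁻¹ * Real.cos (kdot k x) := by
    have hfun : (fun k => soPhiHat d L k * Real.cos (kdot k x)) = fun k =>
        ((1 - soSymbol d L k)⁻¹ * Real.cos (kdot k x) - Real.cos (kdot k x)) -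
          (soVariance d L)⁻¹ * ((dispersion k / d)⁻¹ * Real.cos (kdot k x)) := by
      funext k
      simp only [soPhiHat]
      ring
    rw [hfun, integral_sub (f := fun k => (1 - soSymbol d L k)⁻¹ * Real.cos (kdot k x) -
        Real.cos (kdot k x)) (g := fun k => (soVariance d L)⁻¹ * ((dispersion k / d)⁻¹ *
        Real.cos (kdot k x))) (hAc.sub h1c) (hBc.const_mul _), integral_sub hAc h1c,
      _root_.MeasureTheory.integral_const_mul]
  have hS1 : soGreen d L 1 x =
      ((2 * π) ^ d)⁻¹ * ∫ k in cube d, (1 - soSymbol d L k)⁻¹ * Real.cos (kdot k x) := by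
    rw [soGreen_eq_integral hd hL zero_le_one le_rfl x]
    congr 1
    refine integral_congr_ae (ae_of_all _ fun k => ?_)
    show Real.cos (kdot k x) / (1 - 1 * soSymbol d L k) = (1 - soSymbol d L k)⁻¹ * Real.cos (kdot k x)
    rw [one_mul, div_eq_inv_mul]
  rw [hI, hS1, hδ, srwGreen_eq_integral hd]
  ring

end Literature.Barriers.CriticalPhenomena.SpreadOutIsing

end
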